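import Literature.MathematicalPhysics.QuantumFieldTheory.Balaban1983to89.B10Eq39CollarVolume
import HarnessLib

/-!
# S2β · LINE g18-1 · DET-REP's GEOMETRY ROWS DISCHARGED: the local sums `S_d`, `S_dist`, the ball counts `V` and the separations
# `hsep`, `hsep₂` of the card-free `Δ² log det` rectangle, for ANY index type fibred over the sites of a torus `Site P j`

Cell `ym3-torus` (rung R3: continuum `SU(2)` Yang–Mills on `T³` — NOT `d = 4`, NOT infinite volume, NOT a mass gap, NOT Clay); width copy
`ym3-torus-px19` g10; helper of the crux `stmt-QuantumFields-20520` (`--supports`, NOT a proof of it).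

WHY.  The v10 docking of FOUR-POINT-DECAY (`Lines/semiclassical_s2beta.lean` §4c, stub DET-REP `DetRepLocalised`) displays the rows of
✓`Literature.Analysis.Matrix.abs_fourPt_log_det_le_of_summedProfiles` (p744587): for an index type `ι` of the Faddeev–Popov ∕ slice-Hessian
matrices, a pseudo-distance `dist : ι → ι → ℕ`, profiles `d d′ : ι → ℕ` around the two bonds `b, b′`, the LOCAL SUMS
`Σ_a e^{−θ₂·d a} ≤ S`, `Σ_c e^{−θ₂·dist a c} ≤ S`, the separation `tdist(b, b′) ≤ d a + dist a c + d′ c`, and (for the range editions) the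
ball counts `#{c | dist a c ≤ r} ≤ V`.  In every instantiation `ι` is FIBRED OVER SITES — `ι = (fine bond) × (Lie-algebra basis)`, or
`(site ⊕ pivot) × basis` — by a map `site : ι → Site P j` with fibres of bounded size `m` (`m = 3·d` for bonds × `𝔰𝔲(2)`), and
`dist a c = |site a − site c|₁`, `d a = |site a − x_b|₁`, `d′ c = |site c − x_{b′}|₁`.  THIS FILE discharges ALL those rows for every such
`(ι, site, m)`, with constants UNIFORM in the torus (hence in the depth `K − J` and the volume):
* §1 (generic fibre counting) `sum_comp_le_mul_sum` — `Σ_a g(site a) ≤ m·Σ_y g y` for `g ≥ 0`; `card_filter_comp_le_mul` —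
  `#{a | p (site a)} ≤ m·#{y | p y}`.
* §2 ★`sum_exp_neg_tdist_comp_le` — `Σ_a e^{−θ·|x − site a|₁} ≤ m·(2(1 + θ⁻¹))^d` (lit ✓`B3TorusRadialSums.sum_exp_neg_tdist_le`);
  ★`card_filter_tdist_comp_le` — `#{a | |x − site a|₁ ≤ r} ≤ m·(2r + 1)^d` (lit ✓`B10Eq39CollarVolume.card_ball_le`).
* §3 ★★ THE ROWS IN DET-REP's LETTERS: `hSdi_of_site`, `hSd_of_site`, `hVrow_of_site`, `hVcol_of_site`, `hsep_of_site` (triangle inequality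
  twice, lit ✓`B3Taylor310LocalRemainder.tdist_triangle`), `hsep₂_of_site`.
* §4 ★`abs_sum_le_of_twoProfile`, ★★`abs_fourPt_sum_le_of_twoProfile` — the SUMMATION half of the (JAC) row: per-term two-profile mixed
  responses `|Δ² jl(a)| ≤ η₀·e^{−θ·(d a + d′ a)}` ⟹ `|Δ²(Σ_a jl a)| ≤ η₀·S_d·e^{−(θ−θ₂)·R}`.
So a DET-REP supplier may take `S := m·(2(1 + θ₂⁻¹))^d`, `V := m·(2r + 1)^d` and owes only the ANALYTIC rows (REP)(DET)(LOC) and the per-term (JAC).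

HONEST SCOPE.  Lattice bookkeeping; proves nothing of DET-REP ∕ (BRD) ∕ (OPL) ∕ (CLF) ∕ LAPLACE ∕ S2β ∕ the crux 20520; `YM3TorusSU2` NOT proved;
the Yang–Mills mass gap (Clay) NOT proved.  Def-free; default heartbeats.
References: [Balaban1983Higgs3] CMP 88 (1983) (2.15) p. 427 («summation over Δ(v′) gives O(1)»); [Balaban1985UV3] CMP 102 (1985) p. 258 (ball count);
[Balaban1985Variational] CMP 102 (1985) 277, Thm 1 (10) p. 279.
-/

noncomputable section

open Finset
open Literature.MathematicalPhysics.QuantumFieldTheory.Balaban1983to89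
open Literature.MathematicalPhysics.QuantumFieldTheory.Balaban1983to89.B3Taylor310LocalRemainder (tdist_triangle tdist_comm)

namespace Summit.QuantumFields.YangMills.Theorems.FluctuationComparisonRegPrIntLS2BetaDetRepLocalRows

/-! ## §1 Generic fibre counting along an index map with fibres of size `≤ m` -/

section Fibre

variable {ι σ : Type*} [Fintype ι] [Fintype σ] [DecidableEq σ]

/-- **Pull-back of a non-negative sum along a map with fibres `≤ m`**: `Σ_a g(φ a) ≤ m·Σ_y g y`. [folklore] -/
theorem sum_comp_le_mul_sum (φ : ι → σ) {m : ℕ} (hm : ∀ y, (univ.filter fun a => φ a = y).card ≤ m)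
    (g : σ → ℝ) (hg : ∀ y, 0 ≤ g y) : ∑ a, g (φ a) ≤ m * ∑ y, g y := by
  classical
  rw [Finset.sum_comp]
  calc ∑ y ∈ univ.image φ, ((univ.filter fun a => φ a = y).card) • g y
      ≤ ∑ y ∈ univ.image φ, (m : ℝ) * g y := by
        refine Finset.sum_le_sum fun y _ => ?_
        rw [nsmul_eq_mul]
        exact mul_le_mul_of_nonneg_right (by exact_mod_cast hm y) (hg y)
    _ ≤ ∑ y, (m : ℝ) * g y :=
        Finset.sum_le_sum_of_subset_of_nonneg (Finset.subset_univ _) fun y _ _ => mul_nonneg (Nat.cast_nonneg _) (hg y)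
    _ = m * ∑ y, g y := by rw [Finset.mul_sum]

/-- **Pull-back of a count along a map with fibres `≤ m`**: `#{a | p (φ a)} ≤ m·#{y | p y}`. [folklore] -/
theorem card_filter_comp_le_mul (φ : ι → σ) {m : ℕ} (hm : ∀ y, (univ.filter fun a => φ a = y).card ≤ m)
    (p : σ → Prop) [DecidablePred p] : (univ.filter fun a => p (φ a)).card ≤ m * (univ.filter p).card := by
  classical
  set S := univ.filter fun a => p (φ a) with hS
  have h1 : S.card ≤ m * (S.image φ).card := by
    refine Finset.card_le_mul_card_image S m fun y _ => ?_
    calc (S.filter fun a => φ a = y).card ≤ (univ.filter fun a => φ a = y).card :=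
          Finset.card_le_card (Finset.filter_subset_filter _ (Finset.subset_univ _))
      _ ≤ m := hm y
  have h2 : S.image φ ⊆ univ.filter p := by
    intro y hy
    obtain ⟨a, ha, rfl⟩ := Finset.mem_image.mp hy
    exact Finset.mem_filter.mpr ⟨Finset.mem_univ _, (Finset.mem_filter.mp ha).2⟩
  exact h1.trans (Nat.mul_le_mul_left _ (Finset.card_le_card h2))

end Fibre

/-! ## §2 On the torus: exponential sums and ball counts pulled back along `site : ι → Site P j` -/

section Torus

variable {P : Params} {j : ℕ} {ι : Type*} [Fintype ι]

/-- ★ **Local exponential sums over an index type fibred over sites**: `Σ_a e^{−θ·|x − site a|₁} ≤ m·(2(1 + θ⁻¹))^d`, uniformly in the torus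
(lit ✓`B3TorusRadialSums.sum_exp_neg_tdist_le` pulled back along `site`). [cite: Balaban1983Higgs3, (2.15) p.427] -/
theorem sum_exp_neg_tdist_comp_le (site : ι → Site P j) {m : ℕ} (hm : ∀ y, (univ.filter fun a => site a = y).card ≤ m)
    {θ : ℝ} (hθ : 0 < θ) (x : Site P j) :
    ∑ a, Real.exp (-(θ * (Site.tdist x (site a) : ℝ))) ≤ m * (2 * (1 + θ⁻¹)) ^ P.d := by
  classical
  have h := sum_comp_le_mul_sum site hm (fun y => Real.exp (-(θ * (Site.tdist x y : ℝ)))) fun y => (Real.exp_pos _).le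
  exact h.trans (mul_le_mul_of_nonneg_left (B3TorusRadialSums.sum_exp_neg_tdist_le hθ x) (Nat.cast_nonneg _))

/-- ★ **Ball counts over an index type fibred over sites**: `#{a | |x − site a|₁ ≤ r} ≤ m·(2r + 1)^d` (lit ✓`B10Eq39CollarVolume.card_ball_le`
pulled back along `site`). [cite: Balaban1985UV3, p.258] -/
theorem card_filter_tdist_comp_le (site : ι → Site P j) {m : ℕ} (hm : ∀ y, (univ.filter fun a => site a = y).card ≤ m)
    (x : Site P j) (r : ℕ) :
    (univ.filter fun a => Site.tdist x (site a) ≤ r).card ≤ m * (2 * r + 1) ^ P.d := by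
  classical
  have h := card_filter_comp_le_mul site hm (fun y => Site.tdist x y ≤ r)
  have hb : (univ.filter fun y => Site.tdist x y ≤ r).card ≤ (2 * r + 1) ^ P.d := B10Eq39CollarVolume.card_ball_le x r
  exact h.trans (Nat.mul_le_mul_left _ hb)

/-! ## §3 The rows of DET-REP ∕ `abs_fourPt_log_det_le_of_summedProfiles` in their letters -/

/-- ★★ **Row `hSdi`**: with `dist a c := |site a − site c|₁`, `∀ a, Σ_c e^{−θ₂·dist a c} ≤ m·(2(1 + θ₂⁻¹))^d`. [cite: Balaban1983Higgs3, (2.15) p.427] -/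
theorem hSdi_of_site (site : ι → Site P j) {m : ℕ} (hm : ∀ y, (univ.filter fun a => site a = y).card ≤ m)
    {θ₂ : ℝ} (hθ₂ : 0 < θ₂) (a : ι) :
    ∑ c, Real.exp (-(θ₂ * (Site.tdist (site a) (site c) : ℝ))) ≤ m * (2 * (1 + θ₂⁻¹)) ^ P.d :=
  sum_exp_neg_tdist_comp_le site hm hθ₂ (site a)

/-- ★★ **Row `hSd`**: with `d a := |site a − x_b|₁`, `Σ_a e^{−θ₂·d a} ≤ m·(2(1 + θ₂⁻¹))^d`. [cite: Balaban1983Higgs3, (2.15) p.427] -/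
theorem hSd_of_site (site : ι → Site P j) {m : ℕ} (hm : ∀ y, (univ.filter fun a => site a = y).card ≤ m)
    {θ₂ : ℝ} (hθ₂ : 0 < θ₂) (xb : Site P j) :
    ∑ a, Real.exp (-(θ₂ * (Site.tdist (site a) xb : ℝ))) ≤ m * (2 * (1 + θ₂⁻¹)) ^ P.d := by
  have h := sum_exp_neg_tdist_comp_le site hm hθ₂ xb
  simp only [tdist_comm xb] at h
  exact h

/-- ★★ **Row `hVrow`**: `∀ b, #{c | dist b c ≤ r} ≤ m·(2r + 1)^d`. [cite: Balaban1985UV3, p.258] -/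
theorem hVrow_of_site [DecidableEq ι] (site : ι → Site P j) {m : ℕ} (hm : ∀ y, (univ.filter fun a => site a = y).card ≤ m)
    (r : ℕ) (b : ι) : (univ.filter fun c => Site.tdist (site b) (site c) ≤ r).card ≤ m * (2 * r + 1) ^ P.d :=
  card_filter_tdist_comp_le site hm (site b) r

/-- ★★ **Row `hVcol`**: `∀ a, #{x | dist x a ≤ r} ≤ m·(2r + 1)^d`. [cite: Balaban1985UV3, p.258] -/
theorem hVcol_of_site [DecidableEq ι] (site : ι → Site P j) {m : ℕ} (hm : ∀ y, (univ.filter fun a => site a = y).card ≤ m)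
    (r : ℕ) (a : ι) : (univ.filter fun x => Site.tdist (site x) (site a) ≤ r).card ≤ m * (2 * r + 1) ^ P.d := by
  have h := card_filter_tdist_comp_le site hm (site a) r
  have heq : (univ.filter fun x => Site.tdist (site x) (site a) ≤ r) = (univ.filter fun x => Site.tdist (site a) (site x) ≤ r) := by
    refine Finset.filter_congr fun x _ => ?_
    rw [tdist_comm]
  rw [heq]
  exact h

omit [Fintype ι] in
/-- ★★ **Row `hsep`**: with `d a := |site a − x_b|₁`, `dist a c := |site a − site c|₁`, `d′ c := |site c − x_{b′}|₁`:
`|x_b − x_{b′}|₁ ≤ d a + dist a c + d′ c` (triangle inequality twice). [cite: Balaban1983Higgs3, (3.10) p.435] -/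
theorem hsep_of_site (site : ι → Site P j) (xb xb' : Site P j) (a c : ι) :
    Site.tdist xb xb' ≤ Site.tdist (site a) xb + Site.tdist (site a) (site c) + Site.tdist (site c) xb' := by
  calc Site.tdist xb xb' ≤ Site.tdist xb (site a) + Site.tdist (site a) xb' := tdist_triangle _ _ _
    _ ≤ Site.tdist xb (site a) + (Site.tdist (site a) (site c) + Site.tdist (site c) xb') :=
        Nat.add_le_add_left (tdist_triangle _ _ _) _
    _ = Site.tdist (site a) xb + Site.tdist (site a) (site c) + Site.tdist (site c) xb' := by rw [tdist_comm xb]; ring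

omit [Fintype ι] in
/-- ★★ **Row `hsep₂`**: `|x_b − x_{b′}|₁ ≤ d a + d′ a` (one triangle inequality). [cite: Balaban1983Higgs3, (3.10) p.435] -/
theorem hsep₂_of_site (site : ι → Site P j) (xb xb' : Site P j) (a : ι) :
    Site.tdist xb xb' ≤ Site.tdist (site a) xb + Site.tdist (site a) xb' := by
  calc Site.tdist xb xb' ≤ Site.tdist xb (site a) + Site.tdist (site a) xb' := tdist_triangle _ _ _
    _ = Site.tdist (site a) xb + Site.tdist (site a) xb' := by rw [tdist_comm xb]

end Torus

/-! ## §4 The (JAC) summation row: a mixed difference of a SUM of two-profile-localised local terms -/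

section Jac

variable {ι : Type*} [Fintype ι]

/-- ★ **Sum of two-profile-localised terms**: if `|h a| ≤ η₀·e^{−θ·(d a + d′ a)}` for every index `a`, the two profiles are `R` apart at every
index (`R ≤ d a + d′ a`) and `Σ_a e^{−θ₂·d a} ≤ S_d` for some `0 ≤ θ₂ ≤ θ`, then `|Σ_a h a| ≤ η₀·S_d·e^{−(θ−θ₂)·R}` — the rate `θ − θ₂` to the
separation, `θ₂` to summability. [cite: Balaban1985Variational, Thm 1 (10) p. 279] -/
theorem abs_sum_le_of_twoProfile {h : ι → ℝ} {η₀ θ θ₂ Sd : ℝ} (hη₀ : 0 ≤ η₀) (hθ₂ : 0 ≤ θ₂) (hθ₂θ : θ₂ ≤ θ)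
    {d d' : ι → ℕ} (hh : ∀ a, |h a| ≤ η₀ * Real.exp (-(θ * (d a + d' a))))
    {R : ℕ} (hsep : ∀ a, R ≤ d a + d' a) (hSd : ∑ a, Real.exp (-(θ₂ * d a)) ≤ Sd) :
    |∑ a, h a| ≤ η₀ * Sd * Real.exp (-((θ - θ₂) * R)) := by
  have hexp : ∀ a, Real.exp (-(θ * (d a + d' a))) ≤ Real.exp (-((θ - θ₂) * R)) * Real.exp (-(θ₂ * d a)) := by
    intro a
    rw [← Real.exp_add]
    refine Real.exp_le_exp.2 ?_
    have h : (R : ℝ) ≤ d a + d' a := by exact_mod_cast hsep a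
    have h1 : (0 : ℝ) ≤ d' a := Nat.cast_nonneg _
    have h2 : (0 : ℝ) ≤ d a := Nat.cast_nonneg _
    have h4 : 0 ≤ θ - θ₂ := sub_nonneg.2 hθ₂θ
    nlinarith [mul_le_mul_of_nonneg_left h h4, mul_nonneg hθ₂ h1]
  calc |∑ a, h a| ≤ ∑ a, |h a| := Finset.abs_sum_le_sum_abs _ _
    _ ≤ ∑ a, η₀ * (Real.exp (-((θ - θ₂) * R)) * Real.exp (-(θ₂ * d a))) :=
        Finset.sum_le_sum fun a _ => (hh a).trans (mul_le_mul_of_nonneg_left (hexp a) hη₀)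
    _ = η₀ * Real.exp (-((θ - θ₂) * R)) * ∑ a, Real.exp (-(θ₂ * d a)) := by
        rw [Finset.mul_sum]
        exact Finset.sum_congr rfl fun a _ => by ring
    _ ≤ η₀ * Real.exp (-((θ - θ₂) * R)) * Sd := mul_le_mul_of_nonneg_left hSd (by positivity)
    _ = η₀ * Sd * Real.exp (-((θ - θ₂) * R)) := by ring

/-- ★★ **The (JAC) row of DET-REP from PER-TERM mixed responses**: for local terms `jl : ℝ → ℝ → ι → ℝ` over the rectangle (corners
`(0,0), (1,0), (0,1), (1,1)`) whose MIXED DIFFERENCES are two-profile localised, `|jl 0 0 a − jl 1 0 a − (jl 0 1 a − jl 1 1 a)| ≤ η₀·e^{−θ·(d a + d′ a)}`,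
with `R ≤ d a + d′ a` and `Σ_a e^{−θ₂·d a} ≤ S_d` (`0 ≤ θ₂ ≤ θ`):
`|Σ_a jl 0 0 a − Σ_a jl 1 0 a − (Σ_a jl 0 1 a − Σ_a jl 1 1 a)| ≤ η₀·S_d·e^{−(θ−θ₂)·R}`. [cite: Balaban1985Variational, Thm 1 (10) p. 279] -/
theorem abs_fourPt_sum_le_of_twoProfile {jl : ℝ → ℝ → ι → ℝ} {η₀ θ θ₂ Sd : ℝ} (hη₀ : 0 ≤ η₀) (hθ₂ : 0 ≤ θ₂) (hθ₂θ : θ₂ ≤ θ)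
    {d d' : ι → ℕ} (hjl : ∀ a, |jl 0 0 a - jl 1 0 a - (jl 0 1 a - jl 1 1 a)| ≤ η₀ * Real.exp (-(θ * (d a + d' a))))
    {R : ℕ} (hsep : ∀ a, R ≤ d a + d' a) (hSd : ∑ a, Real.exp (-(θ₂ * d a)) ≤ Sd) :
    |∑ a, jl 0 0 a - ∑ a, jl 1 0 a - (∑ a, jl 0 1 a - ∑ a, jl 1 1 a)| ≤ η₀ * Sd * Real.exp (-((θ - θ₂) * R)) := by
  have heq : ∑ a, jl 0 0 a - ∑ a, jl 1 0 a - (∑ a, jl 0 1 a - ∑ a, jl 1 1 a) =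
      ∑ a, (jl 0 0 a - jl 1 0 a - (jl 0 1 a - jl 1 1 a)) := by
    simp only [Finset.sum_sub_distrib]
  rw [heq]
  exact abs_sum_le_of_twoProfile hη₀ hθ₂ hθ₂θ hjl hsep hSd

end Jac

end Summit.QuantumFields.YangMills.Theorems.FluctuationComparisonRegPrIntLS2BetaDetRepLocalRows

end
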